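import Mathlib.CategoryTheory.Limits.Preserves.Shapes.Products
import Literature.AnabelianGeometry.SemiGraphs.TemperoidsHomHom
import Literature.AnabelianGeometry.SemiGraphs.BTempCoproductsProofs
import Literature.AnabelianGeometry.SemiGraphs.BTempCountablyConnectedProofs

/-!
# [SemiAnbd] Proposition 3.2 (surjectivity half): every morphism of connected temperoids comes from a continuous homomorphism — proof

Mochizuki, *Semi-graphs of anabelioids*, Publ. RIMS **42** (2006) 221–322, §3, Proposition 3.2,
author's manuscript p. 35 [cite: MochizukiSemiAnbd2006, Prop 3.2 p.35]: "the category of morphisms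
`T₁ → T₂` [of the connected temperoids `Tᵢ = B^temp(Πᵢ)`] is equivalent to the category whose
objects are continuous group homomorphisms `φ : Π₁ → Π₂` …; in particular, there is a natural
bijective correspondence between the set of isomorphism classes of morphisms `T₁ → T₂` and the
set of [continuous] outer homomorphisms `Π₁ → Π₂`".  Proof-only companion (no definitions) of
`Temperoids.lean` (p405231): it DISCHARGES the named fact `TemperoidHomEqRes` — every morphism of
temperoids `B^temp(Π₁) → B^temp(Π₂)`, i.e. every functor `Φ^* : B^temp(Π₂) ⥤ B^temp(Π₁)` preserving
finite limits and countable colimits, is isomorphic to `B^temp(φ)` for a continuous `φ : Π₁ → Π₂`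
(node `SemiAnbd:Prop3.2`, surjectivity half; the injectivity half `ResIsoResIff` is
`TemperoidsResProofs.lean`, the first half `ResIsTemperoidHom` is `TemperoidsHomProofs.lean`).

Proof (on top of `TemperoidsHomFibre/Torsor/Hom.lean`).  With the data of
`BTemp.exists_continuousMonoidHom` (base points `y_k ∈ Φ^*(Π₂/N_k)` along a cofinal sequence of
open normal subgroups and the continuous homomorphism `φ` with `a · y_k = y_k · φ(a)`), the
comparison map of an object `X` sends `x` to `θ_X(x) := Φ^*(o_x)(y_k)`, `o_x : Π₂/N_k → X` the orbit
map of `x`.  First part of the file: `θ` is independent of the level, natural in `X`,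
`φ`-equivariant, and bijective on connected (= transitive nonempty) objects (the torsor structure).
Second part: every object is the countable coproduct of its orbits
(`BTempCountablyConnectedProofs.lean`), which `Φ^*` preserves, so `θ` is bijective everywhere and
the `θ_X` assemble into a natural isomorphism `B^temp(φ) ≅ Φ^*`.
-/

namespace Literature.AnabelianGeometry.SemiGraphs

namespace BTemp

open CategoryTheory CategoryTheory.Limits Topology Filter

universe u

section Bookkeeping

variable {G : Type u} [Group G] [TopologicalSpace G]

/-- Morphisms of `B^temp(Π)` are determined by their underlying maps. [folklore] -/
private theorem hom_ext₃ {X Y : BTemp G} (f g : X ⟶ Y) (h : ∀ x, f.hom.hom x = g.hom.hom x) :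
    f = g := by
  apply ObjectProperty.hom_ext
  apply Action.Hom.ext
  exact ConcreteCategory.hom_ext _ _ h

/-- The action of a `Π`-set is multiplicative on elements. [folklore] -/
private theorem ρ_mul_apply₃ (X : BTemp G) (g h : G) (x : X.obj.V) :
    X.obj.ρ (g * h) x = X.obj.ρ g (X.obj.ρ h x) := by
  rw [map_mul]
  rfl

variable [IsTopologicalGroup G] (hG : IsTempered G)

omit [IsTopologicalGroup G] in
/-- Stabilisers grow along morphisms. [cite: MochizukiSemiAnbd2006, Rmk 3.1.2 p.33] -/
theorem stab_le_stab_hom {X X' : BTemp G} (f : X ⟶ X') (x : X.obj.V) :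
    stab X x ≤ stab X' (f.hom.hom x) := by
  intro g hg
  change X'.obj.ρ g (f.hom.hom x) = f.hom.hom x
  rw [← hom_hom_ρ, show X.obj.ρ g x = x from hg]

omit [IsTopologicalGroup G] in
/-- An open NORMAL subgroup fixing `x` fixes every translate of `x`. [cite: MochizukiSemiAnbd2006, Rmk 3.1.2 p.33] -/
theorem le_stab_ρ (N : OpenNormalSubgroup G) (X : BTemp G) (x : X.obj.V)
    (hN : N.toSubgroup ≤ stab X x) (g : G) : N.toSubgroup ≤ stab X (X.obj.ρ g x) := by
  intro n hn
  change X.obj.ρ n (X.obj.ρ g x) = X.obj.ρ g x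
  have hn' : g⁻¹ * n * g ∈ N.toSubgroup := by
    have := N.isNormal'.conj_mem n hn g⁻¹
    rwa [inv_inv] at this
  have hfix : X.obj.ρ (g⁻¹ * n * g) x = x := hN hn'
  rw [← ρ_mul_apply₃, show n * g = g * (g⁻¹ * n * g) by group, ρ_mul_apply₃, hfix]

/-- Orbit maps restrict along the projections: `proj ≫ o_x = o_x`.
[cite: MochizukiSemiAnbd2006, Rmk 3.1.2 p.33] -/
theorem proj_orbitMap {N M : OpenNormalSubgroup G} (h : N ≤ M) (X : BTemp G) (x : X.obj.V)
    (hM : M.toSubgroup ≤ stab X x) (hN : N.toSubgroup ≤ stab X x) :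
    proj hG h ≫ orbitMap hG X x M hM = orbitMap hG X x N hN := by
  apply hom_ext₃
  intro q
  obtain ⟨z, rfl⟩ := QuotientGroup.mk_surjective q
  change (orbitMap hG X x M hM).hom.hom ((proj hG h).hom.hom (z : G ⧸ N.toSubgroup)) = _
  rw [proj_apply, orbitMap_apply, orbitMap_apply]

/-- Orbit maps are natural: `o_x ≫ f = o_{f x}`. [cite: MochizukiSemiAnbd2006, Rmk 3.1.2 p.33] -/
theorem orbitMap_comp_hom (N : OpenNormalSubgroup G) {X X' : BTemp G} (f : X ⟶ X') (x : X.obj.V)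
    (hN : N.toSubgroup ≤ stab X x) (hN' : N.toSubgroup ≤ stab X' (f.hom.hom x)) :
    orbitMap hG X x N hN ≫ f = orbitMap hG X' (f.hom.hom x) N hN' := by
  apply hom_ext₃
  intro q
  obtain ⟨z, rfl⟩ := QuotientGroup.mk_surjective q
  change f.hom.hom ((orbitMap hG X x N hN).hom.hom (z : G ⧸ N.toSubgroup)) = _
  rw [orbitMap_apply, orbitMap_apply, hom_hom_ρ]

/-- Right multiplication then orbit map: `r_g ≫ o_x = o_{g x}`. [cite: MochizukiSemiAnbd2006, Rmk 3.1.2 p.33] -/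
theorem rightMul_orbitMap (N : OpenNormalSubgroup G) (X : BTemp G) (x : X.obj.V)
    (hN : N.toSubgroup ≤ stab X x) (g : G) (hN' : N.toSubgroup ≤ stab X (X.obj.ρ g x)) :
    rightMul hG N g ≫ orbitMap hG X x N hN = orbitMap hG X (X.obj.ρ g x) N hN' := by
  apply hom_ext₃
  intro q
  obtain ⟨z, rfl⟩ := QuotientGroup.mk_surjective q
  change (orbitMap hG X x N hN).hom.hom ((rightMul hG N g).hom.hom (z : G ⧸ N.toSubgroup)) = _
  rw [rightMul_apply, orbitMap_apply, orbitMap_apply, ρ_mul_apply₃]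

end Bookkeeping

variable {G₁ : Type u} [Group G₁] [TopologicalSpace G₁] [IsTopologicalGroup G₁]
  {G₂ : Type u} [Group G₂] [TopologicalSpace G₂] [IsTopologicalGroup G₂] (hG₂ : IsTempered G₂)
  (F : BTemp G₂ ⥤ BTemp G₁) (hlim : PreservesFiniteLimits F)
  (hcolim : ∀ (J : Type) [SmallCategory J] [CountableCategory J], PreservesColimitsOfShape J F)
  (N : ℕ → OpenNormalSubgroup G₂) (y : ∀ k, (F.obj (Q hG₂ (N k))).obj.V)

omit [IsTopologicalGroup G₁] in
/-- **Level independence.**  With compatible base points, `F(o_x)(y_k)` does not depend on the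
level `k` at which the orbit map of `x` is taken. [cite: MochizukiSemiAnbd2006, Prop 3.2 p.35] -/
theorem theta_level_eq (hNanti : Antitone N)
    (hycompat : ∀ j k, j ≤ k → ∀ h : N k ≤ N j, (F.map (proj hG₂ h)).hom.hom (y k) = y j)
    (X : BTemp G₂) (x : X.obj.V) (j k : ℕ) (hj : (N j).toSubgroup ≤ stab X x)
    (hk : (N k).toSubgroup ≤ stab X x) :
    (F.map (orbitMap hG₂ X x (N j) hj)).hom.hom (y j) =
      (F.map (orbitMap hG₂ X x (N k) hk)).hom.hom (y k) := by
  wlog hjk : j ≤ k generalizing j k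
  · exact (this k j hk hj (le_of_not_ge hjk)).symm
  rw [← hycompat j k hjk (hNanti hjk), ← proj_orbitMap hG₂ (hNanti hjk) X x hj hk, F.map_comp]
  rfl

omit [IsTopologicalGroup G₁] in
/-- **Naturality.**  `F(f)(F(o_x) y_k) = F(o_{f x}) y_k`. [cite: MochizukiSemiAnbd2006, Prop 3.2 p.35] -/
theorem theta_natural (k : ℕ) {X X' : BTemp G₂} (f : X ⟶ X') (x : X.obj.V)
    (hk : (N k).toSubgroup ≤ stab X x) (hk' : (N k).toSubgroup ≤ stab X' (f.hom.hom x)) :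
    (F.map f).hom.hom ((F.map (orbitMap hG₂ X x (N k) hk)).hom.hom (y k)) =
      (F.map (orbitMap hG₂ X' (f.hom.hom x) (N k) hk')).hom.hom (y k) := by
  rw [← orbitMap_comp_hom hG₂ (N k) f x hk hk', F.map_comp]
  rfl

omit [IsTopologicalGroup G₁] in
/-- **Equivariance.**  If `a · y_k = F(r_{φ a}) y_k`, then
`a · F(o_x) y_k = F(o_{φ(a) x}) y_k`. [cite: MochizukiSemiAnbd2006, Prop 3.2 p.35] -/
theorem theta_equivariant (φ : G₁ →ₜ* G₂) (k : ℕ)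
    (hφ : ∀ a : G₁, (F.obj (Q hG₂ (N k))).obj.ρ a (y k) =
      (F.map (rightMul hG₂ (N k) (φ a))).hom.hom (y k))
    (X : BTemp G₂) (x : X.obj.V) (hk : (N k).toSubgroup ≤ stab X x) (a : G₁)
    (hk' : (N k).toSubgroup ≤ stab X (X.obj.ρ (φ a) x)) :
    (F.obj X).obj.ρ a ((F.map (orbitMap hG₂ X x (N k) hk)).hom.hom (y k)) =
      (F.map (orbitMap hG₂ X (X.obj.ρ (φ a) x) (N k) hk')).hom.hom (y k) := by
  rw [← hom_hom_ρ, hφ a, ← rightMul_orbitMap hG₂ (N k) X x hk (φ a) hk', F.map_comp]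
  rfl

include hlim hcolim in
/-- **Bijectivity on connected objects.**  For a transitive nonempty `X` (base point `x₀` fixed by
`N_k`), `g x₀ ↦ F(o_{g x₀}) y_k` is a bijection `X → F(X)`: surjective because `F(o_{x₀})` is
surjective onto `F(X)` and `Π₂` is transitive on `Y_k`; injective because the fibres of `F(o_{x₀})`
are the orbits of the stabiliser of `x₀` and `Π₂/N_k` acts freely on `Y_k`.
[cite: MochizukiSemiAnbd2006, Prop 3.2 p.35] -/
theorem theta_bijective_of_transitive (k : ℕ) (X : BTemp G₂) (x₀ : X.obj.V)
    (htr : ∀ x : X.obj.V, ∃ g : G₂, X.obj.ρ g x₀ = x) (hk₀ : (N k).toSubgroup ≤ stab X x₀) :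
    (∀ z : (F.obj X).obj.V, ∃ x : X.obj.V, ∃ hx : (N k).toSubgroup ≤ stab X x,
        (F.map (orbitMap hG₂ X x (N k) hx)).hom.hom (y k) = z) ∧
    ∀ (x x' : X.obj.V) (hx : (N k).toSubgroup ≤ stab X x) (hx' : (N k).toSubgroup ≤ stab X x'),
      (F.map (orbitMap hG₂ X x (N k) hx)).hom.hom (y k) =
        (F.map (orbitMap hG₂ X x' (N k) hx')).hom.hom (y k) → x = x' := by
  obtain ⟨hsurj, hfib⟩ := map_orbitMap hG₂ F hcolim (N k) X x₀ htr hk₀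
  obtain ⟨-, htransY⟩ := fibreQ_transitive hG₂ F hlim hcolim (N k)
  -- `F(o_{g x₀}) y_k = F(o_{x₀}) (F(r_g) y_k)`
  have key : ∀ (g : G₂) (hx : (N k).toSubgroup ≤ stab X (X.obj.ρ g x₀)),
      (F.map (orbitMap hG₂ X (X.obj.ρ g x₀) (N k) hx)).hom.hom (y k) =
        (F.map (orbitMap hG₂ X x₀ (N k) hk₀)).hom.hom
          ((F.map (rightMul hG₂ (N k) g)).hom.hom (y k)) := by
    intro g hx
    rw [← rightMul_orbitMap hG₂ (N k) X x₀ hk₀ g hx, F.map_comp]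
    rfl
  refine ⟨fun z => ?_, fun x x' hx hx' hxx => ?_⟩
  · obtain ⟨y', hy'⟩ := hsurj z
    obtain ⟨g, hg⟩ := htransY (y k) y'
    refine ⟨X.obj.ρ g x₀, le_stab_ρ (N k) X x₀ hk₀ g, ?_⟩
    rw [key, hg, hy']
  · obtain ⟨g, rfl⟩ := htr x
    obtain ⟨g', rfl⟩ := htr x'
    rw [key, key] at hxx
    obtain ⟨h, hh, hhy⟩ := (hfib _ _).mp hxx
    have h1 : (F.map (rightMul hG₂ (N k) (g * h))).hom.hom (y k) =
        (F.map (rightMul hG₂ (N k) g')).hom.hom (y k) := by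
      rw [← hhy, ← rightMul_comp, F.map_comp]
      rfl
    have h2 := fibreQ_coe_eq_of_rightMul_eq hG₂ F hlim hcolim (N k) h1
    -- `g' = g h n` with `n ∈ N_k ⊆ Stab(x₀)` and `h ∈ Stab(x₀)`
    rw [QuotientGroup.eq] at h2
    have h3 : X.obj.ρ ((g * h)⁻¹ * g') x₀ = x₀ := hk₀ h2
    have h4 : X.obj.ρ h x₀ = x₀ := hh
    calc X.obj.ρ g x₀ = X.obj.ρ g (X.obj.ρ h (X.obj.ρ ((g * h)⁻¹ * g') x₀)) := by rw [h3, h4]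
      _ = X.obj.ρ (g * h * ((g * h)⁻¹ * g')) x₀ := by
          rw [ρ_mul_apply₃ X (g * h) ((g * h)⁻¹ * g') x₀, ρ_mul_apply₃ X g h]
      _ = X.obj.ρ g' x₀ := by rw [mul_inv_cancel_left]

end BTemp

open CategoryTheory CategoryTheory.Limits Topology
open Literature.AlgebraicGeometry.Frobenioids (IsConnectedObj)

universe u

namespace BTemp

variable {G : Type u} [Group G] [TopologicalSpace G]

/-- Morphisms of `B^temp(Π)` are determined by their underlying maps. [folklore] -/
private theorem hom_ext₄ {X Y : BTemp G} (f g : X ⟶ Y) (h : ∀ x, f.hom.hom x = g.hom.hom x) :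
    f = g := by
  apply ObjectProperty.hom_ext
  apply Action.Hom.ext
  exact ConcreteCategory.hom_ext _ _ h

/-- Composition in `B^temp(Π)` on elements. [folklore] -/
private theorem comp_hom_hom_apply {X Y Z : BTemp G} (f : X ⟶ Y) (g : Y ⟶ Z) (x : X.obj.V) :
    (f ≫ g).hom.hom x = g.hom.hom (f.hom.hom x) := rfl

/-- An isomorphism of `B^temp(Π)` followed by its inverse is the identity on elements. [folklore] -/
private theorem iso_inv_hom_apply {X Y : BTemp G} (e : X ≅ Y) (x : X.obj.V) :
    e.inv.hom.hom (e.hom.hom.hom x) = x := by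
  rw [← comp_hom_hom_apply, e.hom_inv_id]
  rfl

/-- An isomorphism of `B^temp(Π)` preceded by its inverse is the identity on elements. [folklore] -/
private theorem iso_hom_inv_apply {X Y : BTemp G} (e : X ≅ Y) (y : Y.obj.V) :
    e.hom.hom.hom (e.inv.hom.hom y) = y := by
  rw [← comp_hom_hom_apply, e.inv_hom_id]
  rfl

end BTemp

/-- **[SemiAnbd] Proposition 3.2, surjectivity half** — DISCHARGE of the named fact
`TemperoidHomEqRes` of `Temperoids.lean`: for tempered, second-countable `Π₁`, `Π₂`, every morphism
of temperoids `Φ : B^temp(Π₁) → B^temp(Π₂)` (a functor `Φ^* : B^temp(Π₂) ⥤ B^temp(Π₁)` preserving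
finite limits and countable colimits) satisfies `Φ^* ≅ B^temp(φ)` for some continuous homomorphism
`φ : Π₁ → Π₂`. [cite: MochizukiSemiAnbd2006, Prop 3.2 p.35] -/
theorem TemperoidHomEqRes_holds :
    ∀ (G₁ : Type u) [Group G₁] [TopologicalSpace G₁] (G₂ : Type u) [Group G₂]
      [TopologicalSpace G₂], TemperoidHomEqRes G₁ G₂ := by
  intro G₁ _ _ G₂ _ _ _ _ _ _ _ hG₂ Φ
  classical
  obtain ⟨φ, N, y, hNanti, hNbasis, hycompat, hφ⟩ :=
    BTemp.exists_continuousMonoidHom hG₂ Φ.pullback Φ.preservesFiniteLimits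
      Φ.preservesCountableColimits
  -- every point is fixed by some `N_k`
  have hlev : ∀ (X : BTemp G₂) (x : X.obj.V), ∃ k, (N k).toSubgroup ≤ BTemp.stab X x := by
    intro X x
    have h1 : (BTemp.stab X x : Set G₂) ∈ 𝓝 (1 : G₂) :=
      (X.property.2 x).mem_nhds (BTemp.stab X x).one_mem
    obtain ⟨k, hk⟩ := hNbasis _ h1
    exact ⟨k, fun g hg => hk hg⟩
  let kOf : ∀ X : BTemp G₂, X.obj.V → ℕ := fun X x => Classical.choose (hlev X x)
  have hkOf : ∀ (X : BTemp G₂) (x : X.obj.V), (N (kOf X x)).toSubgroup ≤ BTemp.stab X x :=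
    fun X x => Classical.choose_spec (hlev X x)
  -- the comparison maps
  let θ : ∀ X : BTemp G₂, X.obj.V → (Φ.pullback.obj X).obj.V := fun X x =>
    (Φ.pullback.map (BTemp.orbitMap hG₂ X x (N (kOf X x)) (hkOf X x))).hom.hom (y (kOf X x))
  have hθ : ∀ (X : BTemp G₂) (x : X.obj.V) (k : ℕ) (hk : (N k).toSubgroup ≤ BTemp.stab X x),
      θ X x = (Φ.pullback.map (BTemp.orbitMap hG₂ X x (N k) hk)).hom.hom (y k) :=
    fun X x k hk => BTemp.theta_level_eq hG₂ Φ.pullback N y hNanti hycompat X x _ _ _ _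
  have hnat : ∀ {X X' : BTemp G₂} (f : X ⟶ X') (x : X.obj.V),
      (Φ.pullback.map f).hom.hom (θ X x) = θ X' (f.hom.hom x) := by
    intro X X' f x
    rw [hθ X' (f.hom.hom x) (kOf X x) ((hkOf X x).trans (BTemp.stab_le_stab_hom f x))]
    exact BTemp.theta_natural hG₂ Φ.pullback N y (kOf X x) f x (hkOf X x) _
  have hequiv : ∀ (X : BTemp G₂) (a : G₁) (x : X.obj.V),
      θ X (X.obj.ρ (φ a) x) = (Φ.pullback.obj X).obj.ρ a (θ X x) := by
    intro X a x
    rw [hθ X (X.obj.ρ (φ a) x) (kOf X x) (BTemp.le_stab_ρ (N (kOf X x)) X x (hkOf X x) (φ a))]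
    exact (BTemp.theta_equivariant hG₂ Φ.pullback N y φ (kOf X x) (hφ (kOf X x)) X x
      (hkOf X x) a _).symm
  -- bijective on connected objects
  have hbij_conn : ∀ X : BTemp G₂, IsConnectedObj X → Function.Bijective (θ X) := by
    intro X hX
    obtain ⟨⟨x₀⟩, htr⟩ := (BTemp.isConnectedObj_iff X).mp hX
    have hall : ∀ x : X.obj.V, (N (kOf X x₀)).toSubgroup ≤ BTemp.stab X x := fun x => by
      obtain ⟨g, rfl⟩ := htr x₀ x
      exact BTemp.le_stab_ρ _ X x₀ (hkOf X x₀) g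
    obtain ⟨hs, hi⟩ := BTemp.theta_bijective_of_transitive hG₂ Φ.pullback Φ.preservesFiniteLimits
      Φ.preservesCountableColimits N y (kOf X x₀) X x₀ (htr x₀) (hkOf X x₀)
    constructor
    · intro x x' h
      rw [hθ X x _ (hall x), hθ X x' _ (hall x')] at h
      exact hi x x' (hall x) (hall x') h
    · intro z
      obtain ⟨x, hx, hxz⟩ := hs z
      exact ⟨x, by rw [hθ X x _ hx, hxz]⟩
  -- bijective on all objects: orbit decomposition
  have hbij : ∀ A : BTemp G₂, Function.Bijective (θ A) := by
    intro A
    obtain ⟨ι, _, X, hconn, c, ⟨hc⟩, ⟨e⟩⟩ := BTemp.exists_cofan_orbits A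
    have hc' : IsColimit (Cofan.mk c.pt c.inj) :=
      IsColimit.ofIsoColimit hc (Cocone.ext (Iso.refl _) (by
        rintro ⟨i⟩
        simp only [Cofan.mk_ι_app, Iso.refl_hom]
        rfl))
    haveI : PreservesColimitsOfShape (Discrete ι) Φ.pullback := Φ.preservesCountableColimits _
    have hFc : IsColimit (Cofan.mk (Φ.pullback.obj c.pt) fun i => Φ.pullback.map (c.inj i)) :=
      isColimitCofanMkObjOfIsColimit Φ.pullback X c.inj hc'
    have hbij_pt : Function.Bijective (θ c.pt) := by
      constructor
      · intro p p' h
        obtain ⟨i, v, rfl⟩ := BTemp.cofan_inj_jointly_surjective c.inj hc' p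
        obtain ⟨j, v', rfl⟩ := BTemp.cofan_inj_jointly_surjective c.inj hc' p'
        rw [← hnat, ← hnat] at h
        obtain rfl := BTemp.cofan_eq_of_inj_apply_eq (fun i => Φ.pullback.map (c.inj i)) hFc _ _ h
        rw [(hbij_conn (X i) (hconn i)).1
          (BTemp.cofan_inj_injective (fun i => Φ.pullback.map (c.inj i)) hFc i h)]
      · intro z
        obtain ⟨i, w, rfl⟩ :=
          BTemp.cofan_inj_jointly_surjective (fun i => Φ.pullback.map (c.inj i)) hFc z
        obtain ⟨v, rfl⟩ := (hbij_conn (X i) (hconn i)).2 w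
        exact ⟨(c.inj i).hom.hom v, (hnat (c.inj i) v).symm⟩
    constructor
    · intro x x' h
      have h1 : θ c.pt (e.inv.hom.hom x) = θ c.pt (e.inv.hom.hom x') := by
        rw [← hnat, ← hnat, h]
      have h2 := hbij_pt.1 h1
      rw [← BTemp.iso_hom_inv_apply e x, ← BTemp.iso_hom_inv_apply e x', h2]
    · intro z
      obtain ⟨p, hp⟩ := hbij_pt.2 ((Φ.pullback.map e.inv).hom.hom z)
      refine ⟨e.hom.hom.hom p, ?_⟩
      rw [← hnat, hp, ← BTemp.comp_hom_hom_apply, ← Φ.pullback.map_comp, e.inv_hom_id,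
        Φ.pullback.map_id]
      rfl
  -- the natural isomorphism `B^temp(φ) ≅ Φ^*`
  let E : ∀ X : BTemp G₂, X.obj.V ≃ (Φ.pullback.obj X).obj.V := fun X =>
    Equiv.ofBijective (θ X) (hbij X)
  have hE : ∀ (X : BTemp G₂) (x : X.obj.V), E X x = θ X x := fun X x => rfl
  let η : ∀ X : BTemp G₂, (BTemp.res φ).obj X ≅ Φ.pullback.obj X := fun X =>
    { hom := BTemp.homOfEquivariant ((BTemp.res φ).obj X) (Φ.pullback.obj X) (θ X)
        (fun a x => hequiv X a x)
      inv := BTemp.homOfEquivariant (Φ.pullback.obj X) ((BTemp.res φ).obj X) (E X).symm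
        (fun a z => by
          apply (hbij X).1
          change θ X ((E X).symm _) = θ X (X.obj.ρ (φ a) ((E X).symm z))
          rw [hequiv, ← hE, ← hE, Equiv.apply_symm_apply, Equiv.apply_symm_apply])
      hom_inv_id := by
        apply BTemp.hom_ext₄
        intro x
        change (E X).symm (θ X x) = x
        rw [← hE, Equiv.symm_apply_apply]
      inv_hom_id := by
        apply BTemp.hom_ext₄
        intro z
        change θ X ((E X).symm z) = z
        rw [← hE, Equiv.apply_symm_apply] }
  refine ⟨φ, ⟨(NatIso.ofComponents η (fun {X Y} f => ?_)).symm⟩⟩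
  apply BTemp.hom_ext₄
  intro x
  change θ Y (f.hom.hom x) = (Φ.pullback.map f).hom.hom (θ X x)
  rw [hnat]

end Literature.AnabelianGeometry.SemiGraphs
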